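import Summits.AtomisticToContinuum.HydrodynamicLimit.Theorems.AntiMazurCoboundariesCorrectorPressureDecayKiferWallGibbsSanity

/-!
# The GNZ density sandwich for hard-sphere Gibbs states, I: deletion, and the upper bound `E[#Λ] ≤ z · vol Λ`

Helper file (1/3) of crux stmt-AtomisticToContinuum-14135 `AntiMazurCoboundaries.CorrectorPressureDecay`, line `FirstLemma`
(idea `kifer-compactification`), namespace `…Theorems.KiferCompactification`; registered helper stub
`stub_gibbsIntensityLeActivity`; serves the registered stub `stub_activityBound` and the former stub
`stub_ruelleDiluteHardSphereGas` (the order clause `z - C z² ≤ ρ(z) ≤ z` of Ruelle's dilute-gas fact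
`Literature.MathematicalPhysics.StatisticalMechanics.RuelleDiluteHardSphereGas`, Ruelle 1969 Thm 4.2.3 / eq. (3.12)) and the
activity bound `HardSphereGibbsActivityBound` of the line's skeleton, by proving the activity–density relation directly from the
DLR equation for EVERY hard-sphere Gibbs state. Notation: `γ_Λ(· | Y)` the finite-volume specification of
`Literature.Analysis.FluidPDE.IsHardSphereGibbs ε z β u` (`gibbsWeightMeasure`, `gibbsSpecMeasure` of
`…KiferWallGibbsSanitySpec.lean`), `m = maxwellPhaseMeasure β u Λ` the one-particle a-priori law (`m(univ) = vol Λ` for `β > 0`,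
`maxwellPhaseMeasure_univ`), `w(Y) = ∑ₖ (zᵏ/k!) m^{⊗k}{hard core}` the normalising weight (`gibbsWeight_univ_eq_tsum`). Here:

* one thrown particle more or less: `Fin.cons` as the inverse of `MeasurableEquiv.piFinSuccAbove` (`lintegral_prod_pi_cons`,
  `pi_succ_apply_eq_prod`), deletion keeps the hard core (`hardCoreIn_superposeIn_of_cons`), insertion into a vacant ball keeps
  it (`hardCoreIn_superposeIn_cons`); coincidences are `m^{⊗k}`-null and a.s. the thrown points are distinct with positions in
  `Λ` (`ae_pi_maxwellPhaseMeasure_good`), so that exactly `k` of them lie above `Λ` (`count_superposeIn_eq_of_injective`);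
* the UPPER BOUND (Ruelle 1969 (2.5), `ρ_Λ ≤ z`): `m^{⊗(k+1)}{hc} ≤ m(univ) m^{⊗k}{hc}` (`pi_hardCore_succ_le`), whence
  `E_W[#Λ] ≤ z m(univ) w(Y)`, `E_{γ(·|Y)}[#Λ] ≤ z m(univ)` and, by the DLR equation for functions,
  `E_μ[#(particles above Λ)] ≤ z · vol Λ` for every Gibbs state (`lintegral_count_le_activity_mul_volume`).

The lower bound (GNZ insertion inequality) is in `…KiferGibbsDensityGNZ.lean`, the translation-invariant density sandwich in
`…KiferGibbsDensity.lean`.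
-/

noncomputable section

open MeasureTheory ProbabilityTheory Set Filter Topology Function
open scoped ENNReal

namespace Summit.AtomisticToContinuum.HydrodynamicLimit.Theorems.KiferCompactification

open Literature.Analysis.FluidPDE (IsHardSphereGibbs HardCoreIn superposeIn gibbsWeight gibbsSpec maxwellPhaseMeasure)
open Literature.Analysis.FunctionSpaces (PointConfig)
open Literature.MathematicalPhysics.KineticTheory (V3 gaussMeasure)

/-! ## Deleting and inserting one thrown particle -/

section Insertion

/-- The hard core in a window is inherited by sub-configurations. -/
theorem hardCoreIn_anti {ε : ℝ} {Λ : Set V3} {X X' : PointConfig (V3 × V3)} (h : ∀ p ∈ X, p ∈ X')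
    (hX' : HardCoreIn ε Λ X') : HardCoreIn ε Λ X :=
  fun p hp q hq hpq hΛ => hX' p (h p hp) q (h q hq) hpq hΛ

/-- Membership in the superposition of `k + 1` thrown points `Fin.cons p x`: the new point (if its position is in `Λ`)
or a member of the superposition of `x`. -/
theorem mem_superposeIn_cons_iff (Λ : Set V3) {n : ℕ} (p : V3 × V3) (x : Fin n → V3 × V3) (Y : PointConfig (V3 × V3))
    (a : V3 × V3) : a ∈ superposeIn Λ (Fin.cons p x : Fin (n + 1) → V3 × V3) Y ↔ (a = p ∧ p.1 ∈ Λ) ∨ a ∈ superposeIn Λ x Y := by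
  rw [mem_superposeIn_iff, mem_superposeIn_iff, Fin.range_cons, Set.mem_insert_iff]
  constructor
  · rintro (⟨rfl | ha, haΛ⟩ | h)
    · exact Or.inl ⟨rfl, haΛ⟩
    · exact Or.inr (Or.inl ⟨ha, haΛ⟩)
    · exact Or.inr (Or.inr h)
  · rintro (⟨rfl, hpΛ⟩ | ⟨ha, haΛ⟩ | h)
    · exact Or.inl ⟨Or.inl rfl, hpΛ⟩
    · exact Or.inl ⟨Or.inr ha, haΛ⟩
    · exact Or.inr h

/-- **Deleting a thrown particle keeps the hard core.** -/
theorem hardCoreIn_superposeIn_of_cons {ε : ℝ} {Λ : Set V3} {n : ℕ} {p : V3 × V3} {x : Fin n → V3 × V3}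
    {Y : PointConfig (V3 × V3)} (h : HardCoreIn ε Λ (superposeIn Λ (Fin.cons p x : Fin (n + 1) → V3 × V3) Y)) :
    HardCoreIn ε Λ (superposeIn Λ x Y) :=
  hardCoreIn_anti (fun a ha => (mem_superposeIn_cons_iff Λ p x Y a).2 (Or.inr ha)) h

/-- **Inserting a particle into a vacant ball keeps the hard core**: if no particle of `superposeIn Λ x Y` has its centre in
the open ball `B(p.1, ε)`, throwing `p` in addition does not violate the hard core in `Λ`. -/
theorem hardCoreIn_superposeIn_cons {ε : ℝ} {Λ : Set V3} {n : ℕ} {p : V3 × V3} {x : Fin n → V3 × V3}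
    {Y : PointConfig (V3 × V3)} (h : HardCoreIn ε Λ (superposeIn Λ x Y))
    (h0 : (superposeIn Λ x Y).count (Metric.ball p.1 ε ×ˢ (univ : Set V3)) = 0) :
    HardCoreIn ε Λ (superposeIn Λ (Fin.cons p x : Fin (n + 1) → V3 × V3) Y) := by
  have hfar : ∀ b ∈ superposeIn Λ x Y, ε ≤ ‖p.1 - b.1‖ := by
    intro b hb
    rw [PointConfig.count, Set.encard_eq_zero, Set.eq_empty_iff_forall_notMem] at h0
    have hb' : b ∉ Metric.ball p.1 ε ×ˢ (univ : Set V3) := fun hbS => h0 b ⟨hb, hbS⟩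
    rw [Set.mem_prod, Metric.mem_ball, not_and_or] at hb'
    rcases hb' with hb' | hb'
    · rw [not_lt, dist_eq_norm, norm_sub_rev] at hb'
      exact hb'
    · exact absurd (mem_univ _) hb'
  intro a ha b hb hab hΛ
  rcases (mem_superposeIn_cons_iff Λ p x Y a).1 ha with ⟨hap, -⟩ | ha' <;>
    rcases (mem_superposeIn_cons_iff Λ p x Y b).1 hb with ⟨hbp, -⟩ | hb'
  · exact absurd (hap.trans hbp.symm) hab
  · rw [hap]; exact hfar b hb'
  · rw [hbp, norm_sub_rev]; exact hfar a ha'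
  · exact h a ha' b hb' hab hΛ

/-- If the thrown points are distinct with positions in `Λ`, exactly `k` particles of the superposition lie above `Λ`. -/
theorem count_superposeIn_eq_of_injective (Λ : Set V3) {n : ℕ} {x : Fin n → V3 × V3} (hx : ∀ i, (x i).1 ∈ Λ)
    (hinj : Function.Injective x) (Y : PointConfig (V3 × V3)) :
    (superposeIn Λ x Y).count (Λ ×ˢ (univ : Set V3)) = n := by
  have hset : (superposeIn Λ x Y).carrier ∩ Λ ×ˢ (univ : Set V3) = Set.range x := by
    ext a
    simp only [mem_inter_iff, PointConfig.mem_carrier, mem_superposeIn_iff, mem_prod, mem_univ, and_true]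
    constructor
    · rintro ⟨⟨ha, -⟩ | ⟨-, haΛ⟩, haΛ'⟩
      · exact ha
      · exact absurd haΛ' haΛ
    · rintro ⟨i, rfl⟩
      exact ⟨Or.inl ⟨⟨i, rfl⟩, hx i⟩, hx i⟩
  rw [PointConfig.count, hset, ← Set.image_univ, hinj.injOn.encard_image, Set.encard_univ, ENat.card_eq_coe_fintype_card,
    Fintype.card_fin]

end Insertion

/-! ## Splitting off one coordinate of the `k + 1`-fold a-priori law -/

section Split

variable (m : Measure (V3 × V3)) [SigmaFinite m]

/-- The inverse of `piFinSuccAbove` at the coordinate `0` is `Fin.cons`. -/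
theorem piFinSuccAbove_zero_symm_apply' (n : ℕ) (q : (V3 × V3) × (Fin n → V3 × V3)) :
    (MeasurableEquiv.piFinSuccAbove (fun _ : Fin (n + 1) => V3 × V3) 0).symm q = Fin.cons q.1 q.2 := by
  simp [MeasurableEquiv.piFinSuccAbove, Fin.insertNthEquiv, Fin.insertNth_zero']

/-- `(p, x) ↦ Fin.cons p x` is measurable. -/
theorem measurable_finCons (n : ℕ) :
    Measurable fun q : (V3 × V3) × (Fin n → V3 × V3) => (Fin.cons q.1 q.2 : Fin (n + 1) → V3 × V3) := by
  have h := (MeasurableEquiv.piFinSuccAbove (fun _ : Fin (n + 1) => V3 × V3) 0).symm.measurable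
  refine (congrArg Measurable (funext fun q => ?_)).mp h
  exact piFinSuccAbove_zero_symm_apply' n q

/-- **Fubini for the first thrown point**: `∫ f dm^{⊗(k+1)} = ∫ f(cons p x) d(m ⊗ m^{⊗k})(p, x)`. -/
theorem lintegral_prod_pi_cons (n : ℕ) (f : (Fin (n + 1) → V3 × V3) → ℝ≥0∞) :
    ∫⁻ q, f (Fin.cons q.1 q.2) ∂(m.prod (Measure.pi fun _ : Fin n => m)) = ∫⁻ x, f x ∂(Measure.pi fun _ : Fin (n + 1) => m) := by
  have hmp := measurePreserving_piFinSuccAbove (fun _ : Fin (n + 1) => m) 0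
  set e := MeasurableEquiv.piFinSuccAbove (fun _ : Fin (n + 1) => V3 × V3) 0 with he
  have h1 : (fun q : (V3 × V3) × (Fin n → V3 × V3) => f (Fin.cons q.1 q.2)) = fun q => f (e.symm q) := by
    funext q
    rw [piFinSuccAbove_zero_symm_apply']
  rw [h1, ← hmp.lintegral_comp_emb e.measurableEmbedding (fun q => f (e.symm q))]
  simp only [MeasurableEquiv.symm_apply_apply]

/-- The `m^{⊗(k+1)}`-measure of a set is the `m ⊗ m^{⊗k}`-measure of its preimage under `cons`. -/
theorem pi_succ_apply_eq_prod (n : ℕ) (S : Set (Fin (n + 1) → V3 × V3)) :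
    (Measure.pi fun _ : Fin (n + 1) => m) S =
      (m.prod (Measure.pi fun _ : Fin n => m)) ((fun q : (V3 × V3) × (Fin n → V3 × V3) => (Fin.cons q.1 q.2 : Fin (n + 1) → V3 × V3)) ⁻¹' S) := by
  have hmp := (measurePreserving_piFinSuccAbove (fun _ : Fin (n + 1) => m) 0).symm
  rw [← hmp.measure_preimage_equiv S]
  congr 1
  ext q
  simp only [mem_preimage, piFinSuccAbove_zero_symm_apply']

/-- **Deleting a particle**: `m^{⊗(k+1)}{hard core} ≤ m(univ) · m^{⊗k}{hard core}`. -/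
theorem pi_hardCore_succ_le (ε : ℝ) (Λ : Set V3) (Y : PointConfig (V3 × V3)) (n : ℕ) :
    (Measure.pi fun _ : Fin (n + 1) => m) {x | HardCoreIn ε Λ (superposeIn Λ x Y)} ≤
      m univ * (Measure.pi fun _ : Fin n => m) {x | HardCoreIn ε Λ (superposeIn Λ x Y)} := by
  rw [pi_succ_apply_eq_prod, ← Measure.prod_prod]
  exact measure_mono fun q hq => ⟨mem_univ _, hardCoreIn_superposeIn_of_cons hq⟩

/-- Coincidences of two thrown points are `m^{⊗k}`-null when `m` has no atoms. -/
theorem pi_setOf_apply_eq_apply_eq_zero (hm : ∀ a, m {a} = 0) {n : ℕ} {i j : Fin n} (hij : i ≠ j) :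
    (Measure.pi fun _ : Fin n => m) {x | x i = x j} = 0 := by
  cases n with
  | zero => exact i.elim0
  | succ n =>
    obtain ⟨j₀, rfl⟩ := Fin.exists_succAbove_eq hij.symm
    have hmp := measurePreserving_piFinSuccAbove (fun _ : Fin (n + 1) => m) i
    set e := MeasurableEquiv.piFinSuccAbove (fun _ : Fin (n + 1) => V3 × V3) i with he
    have hset : {x : Fin (n + 1) → V3 × V3 | x i = x (i.succAbove j₀)} =
        e ⁻¹' {q : (V3 × V3) × (Fin n → V3 × V3) | q.1 = q.2 j₀} := by
      ext x
      simp [he, MeasurableEquiv.piFinSuccAbove_apply, Fin.insertNthEquiv_symm_apply, Fin.removeNth_apply]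
    have hT : MeasurableSet {q : (V3 × V3) × (Fin n → V3 × V3) | q.1 = q.2 j₀} :=
      measurableSet_eq_fun measurable_fst ((measurable_pi_apply j₀).comp measurable_snd)
    rw [hset, hmp.measure_preimage_equiv, Measure.measure_prod_null hT]
    refine ae_of_all _ fun a => ?_
    have h1 : Prod.mk a ⁻¹' {q : (V3 × V3) × (Fin n → V3 × V3) | q.1 = q.2 j₀} =
        (Function.eval j₀ : (Fin n → V3 × V3) → V3 × V3) ⁻¹' {a} := by
      ext y
      simp only [mem_preimage, mem_setOf_eq, mem_singleton_iff, eq_comm]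
    simp only [Pi.zero_apply, h1]
    exact Measure.pi_eval_preimage_null (fun _ : Fin n => m) (hm a)

end Split

/-! ## The one-particle a-priori law -/

section APriori

/-- The a-priori law is `Leb|_Λ ⊗ 𝒩(u, β⁻¹ I)` for `β > 0`. -/
theorem maxwellPhaseMeasure_eq_prod_gaussMeasure {β : ℝ} (hβ : 0 < β) (u : V3) (Λ : Set V3) :
    maxwellPhaseMeasure β u Λ = ((volume : Measure V3).restrict Λ).prod (gaussMeasure u β⁻¹) := by
  have h := maxwellPhaseMeasure_inv_eq_prod_gaussMeasure (inv_pos.2 hβ) u Λ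
  rwa [inv_inv] at h

/-- Total mass of the a-priori law: `m(univ) = vol Λ` for `β > 0` (the Maxwellian is a probability density). -/
theorem maxwellPhaseMeasure_univ {β : ℝ} (hβ : 0 < β) (u : V3) (Λ : Set V3) :
    maxwellPhaseMeasure β u Λ univ = volume Λ := by
  rw [maxwellPhaseMeasure_eq_prod_gaussMeasure hβ, ← univ_prod_univ, Measure.prod_prod, Measure.restrict_apply_univ,
    measure_univ, mul_one]

/-- The a-priori law has no atoms. -/
theorem maxwellPhaseMeasure_singleton {β : ℝ} (hβ : 0 < β) (u : V3) (Λ : Set V3) (a : V3 × V3) :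
    maxwellPhaseMeasure β u Λ {a} = 0 := by
  have h0 : ((volume : Measure V3).restrict Λ) {a.1} = 0 :=
    nonpos_iff_eq_zero.1 ((Measure.le_iff'.1 Measure.restrict_le_self {a.1}).trans_eq (measure_singleton a.1))
  rw [maxwellPhaseMeasure_eq_prod_gaussMeasure hβ, show ({a} : Set (V3 × V3)) = {a.1} ×ˢ {a.2} by
    rw [singleton_prod_singleton], Measure.prod_prod, h0, zero_mul]

/-- **Under `m^{⊗k}` a.s. all thrown positions lie in `Λ` and the thrown points are pairwise distinct.** -/
theorem ae_pi_maxwellPhaseMeasure_good {β : ℝ} (hβ : 0 < β) (u : V3) {Λ : Set V3} (hΛ : MeasurableSet Λ) (n : ℕ) :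
    ∀ᵐ x ∂(Measure.pi fun _ : Fin n => maxwellPhaseMeasure β u Λ), (∀ i, (x i).1 ∈ Λ) ∧ Function.Injective x := by
  haveI := sigmaFinite_maxwellPhaseMeasure β u Λ
  set m := maxwellPhaseMeasure β u Λ with hm
  have hout : m (Prod.fst ⁻¹' Λᶜ) = 0 := by
    rw [hm, maxwellPhaseMeasure_eq_prod_gaussMeasure hβ, ← Set.prod_univ, Measure.prod_prod,
      Measure.restrict_apply hΛ.compl, Set.compl_inter_self, measure_empty, zero_mul]
  have h1 : ∀ᵐ x ∂(Measure.pi fun _ : Fin n => m), ∀ i, (x i).1 ∈ Λ := by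
    refine ae_all_iff.2 fun i => ?_
    rw [ae_iff]
    exact Measure.pi_eval_preimage_null (fun _ : Fin n => m) (i := i) hout
  have h2 : ∀ᵐ x ∂(Measure.pi fun _ : Fin n => m), ∀ i j, i ≠ j → x i ≠ x j := by
    refine ae_all_iff.2 fun i => ae_all_iff.2 fun j => ?_
    by_cases hij : i = j
    · exact ae_of_all _ fun x h => absurd hij h
    · have h0 := pi_setOf_apply_eq_apply_eq_zero m (maxwellPhaseMeasure_singleton hβ u Λ) hij
      have h0' : ∀ᵐ x ∂(Measure.pi fun _ : Fin n => m), x i ≠ x j := by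
        rw [ae_iff]
        simpa only [ne_eq, not_not] using h0
      filter_upwards [h0'] with x hx using fun _ => hx
  filter_upwards [h1, h2] with x hx1 hx2
  exact ⟨hx1, fun i j hij => by_contra fun h => hx2 i j h hij⟩

end APriori

/-! ## The upper bound: `E_{γ(·|Y)}[#Λ] ≤ z · m(univ)` -/

section Upper

/-- The normalising weight as a series of hard-core masses: `w(Y) = ∑ₖ (zᵏ/k!) m^{⊗k}{hard core}`. -/
theorem gibbsWeight_univ_eq_tsum (ε z β : ℝ) (u : V3) {Λ : Set V3} (hΛ : MeasurableSet Λ) (Y : PointConfig (V3 × V3)) :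
    gibbsWeight ε z β u Λ Y univ = ∑' k : ℕ, ENNReal.ofReal (z ^ k / (Nat.factorial k)) *
      (Measure.pi fun _ : Fin k => maxwellPhaseMeasure β u Λ) {x | HardCoreIn ε Λ (superposeIn Λ x Y)} := by
  calc gibbsWeight ε z β u Λ Y univ = gibbsWeightMeasure ε z β u Λ Y univ :=
        (gibbsWeightMeasure_apply ε z β u hΛ Y MeasurableSet.univ).symm
    _ = ∫⁻ _, 1 ∂(gibbsWeightMeasure ε z β u Λ Y) := lintegral_one.symm
    _ = _ := by
        rw [lintegral_gibbsWeightMeasure ε z β u hΛ Y measurable_const]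
        simp only [setLIntegral_one]

/-- `(z^{k+1}/(k+1)!) (k+1) = z · zᵏ/k!` in `ℝ≥0∞`, for `z ≥ 0`. -/
theorem ofReal_pow_succ_div_factorial_mul {z : ℝ} (hz : 0 ≤ z) (n : ℕ) :
    ENNReal.ofReal (z ^ (n + 1) / (Nat.factorial (n + 1))) * ((n + 1 : ℕ) : ℝ≥0∞) =
      ENNReal.ofReal z * ENNReal.ofReal (z ^ n / (Nat.factorial n)) := by
  rw [← ENNReal.ofReal_natCast, ← ENNReal.ofReal_mul (by positivity), ← ENNReal.ofReal_mul hz]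
  congr 1
  rw [Nat.factorial_succ, Nat.cast_mul]
  have hf : (0 : ℝ) < (Nat.factorial n : ℕ) := by positivity
  have hn : (0 : ℝ) < ((n + 1 : ℕ) : ℝ) := by positivity
  field_simp
  ring

/-- **`E_{W(·|Y)}[#Λ] ≤ z · m(univ) · w(Y)`** (Ruelle 1969 (2.5) at the level of the un-normalised weight): at most `k`
particles above `Λ` in the `k`-th term, and `k (zᵏ/k!) m^{⊗k}{hc} ≤ z m(univ) (z^{k-1}/(k-1)!) m^{⊗(k-1)}{hc}`. -/
theorem lintegral_count_gibbsWeightMeasure_le_activity (ε : ℝ) {z : ℝ} (hz : 0 ≤ z) (β : ℝ) (u : V3) {Λ : Set V3}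
    (hΛ : MeasurableSet Λ) (Y : PointConfig (V3 × V3)) :
    ∫⁻ X, ((X.count (Λ ×ˢ (univ : Set V3)) : ℕ∞) : ℝ≥0∞) ∂(gibbsWeightMeasure ε z β u Λ Y) ≤
      ENNReal.ofReal z * maxwellPhaseMeasure β u Λ univ * gibbsWeight ε z β u Λ Y univ := by
  haveI := sigmaFinite_maxwellPhaseMeasure β u Λ
  rw [lintegral_gibbsWeightMeasure ε z β u hΛ Y (measurable_toENNReal_count (hΛ.prod MeasurableSet.univ)),
    gibbsWeight_univ_eq_tsum ε z β u hΛ Y]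
  set m := maxwellPhaseMeasure β u Λ with hm
  set P : ℕ → ℝ≥0∞ := fun k => (Measure.pi fun _ : Fin k => m) {x | HardCoreIn ε Λ (superposeIn Λ x Y)} with hP
  set c : ℕ → ℝ≥0∞ := fun k => ENNReal.ofReal (z ^ k / (Nat.factorial k)) with hc
  set N : ℕ → ℝ≥0∞ := fun k => ∫⁻ x in {x : Fin k → V3 × V3 | HardCoreIn ε Λ (superposeIn Λ x Y)},
      (((superposeIn Λ x Y).count (Λ ×ˢ (univ : Set V3)) : ℕ∞) : ℝ≥0∞) ∂(Measure.pi fun _ : Fin k => m) with hN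
  show ∑' k, c k * N k ≤ ENNReal.ofReal z * m univ * ∑' k, c k * P k
  have hterm : ∀ k : ℕ, N k ≤ k * P k := by
    intro k
    calc N k ≤ ∫⁻ _ in {x : Fin k → V3 × V3 | HardCoreIn ε Λ (superposeIn Λ x Y)}, (k : ℝ≥0∞)
          ∂(Measure.pi fun _ : Fin k => m) :=
          lintegral_mono fun x =>
            (ENat.toENNReal_le.2 (count_superposeIn_prod_univ_le Λ x Y)).trans_eq (ENat.toENNReal_coe k)
      _ = k * P k := setLIntegral_const _ _
  have hsucc : ∀ n : ℕ, c (n + 1) * (((n + 1 : ℕ) : ℝ≥0∞) * P (n + 1)) ≤ ENNReal.ofReal z * m univ * (c n * P n) := by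
    intro n
    calc c (n + 1) * (((n + 1 : ℕ) : ℝ≥0∞) * P (n + 1)) = ENNReal.ofReal z * c n * P (n + 1) := by
          rw [← mul_assoc, hc]
          dsimp only
          rw [ofReal_pow_succ_div_factorial_mul hz n]
      _ ≤ ENNReal.ofReal z * c n * (m univ * P n) := mul_le_mul' le_rfl (pi_hardCore_succ_le m ε Λ Y n)
      _ = _ := by ring
  calc ∑' k, c k * N k ≤ ∑' k, c k * ((k : ℝ≥0∞) * P k) := ENNReal.tsum_le_tsum fun k => mul_le_mul' le_rfl (hterm k)
    _ = c 0 * (((0 : ℕ) : ℝ≥0∞) * P 0) + ∑' n : ℕ, c (n + 1) * (((n + 1 : ℕ) : ℝ≥0∞) * P (n + 1)) :=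
        tsum_eq_zero_add' ENNReal.summable
    _ = ∑' n : ℕ, c (n + 1) * (((n + 1 : ℕ) : ℝ≥0∞) * P (n + 1)) := by
        rw [Nat.cast_zero, zero_mul, mul_zero, zero_add]
    _ ≤ ∑' n : ℕ, ENNReal.ofReal z * m univ * (c n * P n) := ENNReal.tsum_le_tsum hsucc
    _ = ENNReal.ofReal z * m univ * ∑' n : ℕ, c n * P n := ENNReal.tsum_mul_left

/-- **`E_{γ(·|Y)}[#Λ] ≤ z · m(univ)`** for every boundary condition (Ruelle 1969 (2.5), `ρ_Λ(x) ≤ z`). -/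
theorem lintegral_count_gibbsSpecMeasure_le_activity (ε : ℝ) {z : ℝ} (hz : 0 ≤ z) (β : ℝ) (u : V3) {Λ : Set V3}
    (hΛ : MeasurableSet Λ) (Y : PointConfig (V3 × V3)) :
    ∫⁻ X, ((X.count (Λ ×ˢ (univ : Set V3)) : ℕ∞) : ℝ≥0∞) ∂(gibbsSpecMeasure ε z β u Λ Y) ≤
      ENNReal.ofReal z * maxwellPhaseMeasure β u Λ univ := by
  rw [lintegral_gibbsSpecMeasure]
  by_cases hw : gibbsWeight ε z β u Λ Y univ = ∞
  · rw [hw, ENNReal.inv_top, zero_mul]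
    exact zero_le
  calc (gibbsWeight ε z β u Λ Y univ)⁻¹ * ∫⁻ X, ((X.count (Λ ×ˢ (univ : Set V3)) : ℕ∞) : ℝ≥0∞) ∂(gibbsWeightMeasure ε z β u Λ Y)
      ≤ (gibbsWeight ε z β u Λ Y univ)⁻¹ *
          (ENNReal.ofReal z * maxwellPhaseMeasure β u Λ univ * gibbsWeight ε z β u Λ Y univ) :=
        mul_le_mul' le_rfl (lintegral_count_gibbsWeightMeasure_le_activity ε hz β u hΛ Y)
    _ = ENNReal.ofReal z * maxwellPhaseMeasure β u Λ univ *
          ((gibbsWeight ε z β u Λ Y univ)⁻¹ * gibbsWeight ε z β u Λ Y univ) := by ring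
    _ = _ := by rw [ENNReal.inv_mul_cancel (gibbsWeight_univ_ne_zero ε z β u Λ Y) hw, mul_one]

/-- **Intensity bound for a Gibbs state, sharp form**: `E_μ[#(particles above Λ)] ≤ z · m(Λ × ℝ³)` for every bounded
measurable window (no hypothesis on `β`; `m` the one-particle a-priori law). -/
theorem lintegral_count_le_activity_mul_mass {ε z β : ℝ} {u : V3} {μ : Measure (PointConfig (V3 × V3))}
    (h : IsHardSphereGibbs ε z β u μ) (hz : 0 ≤ z) {Λ : Set V3} (hΛ : MeasurableSet Λ) (hΛb : Bornology.IsBounded Λ) :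
    ∫⁻ X, ((X.count (Λ ×ˢ (univ : Set V3)) : ℕ∞) : ℝ≥0∞) ∂μ ≤ ENNReal.ofReal z * maxwellPhaseMeasure β u Λ univ := by
  haveI := h.1
  rw [lintegral_eq_lintegral_gibbsSpecMeasure h hΛ hΛb
    (measurable_toENNReal_count (hΛ.prod MeasurableSet.univ)).aemeasurable]
  calc ∫⁻ Y, ∫⁻ X, ((X.count (Λ ×ˢ (univ : Set V3)) : ℕ∞) : ℝ≥0∞) ∂(gibbsSpecMeasure ε z β u Λ Y) ∂μ
      ≤ ∫⁻ _, ENNReal.ofReal z * maxwellPhaseMeasure β u Λ univ ∂μ :=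
        lintegral_mono fun Y => lintegral_count_gibbsSpecMeasure_le_activity ε hz β u hΛ Y
    _ = _ := by rw [lintegral_const, show μ univ = 1 from measure_univ, mul_one]

/-- **`E_μ[#(particles above Λ)] ≤ z · vol Λ`** for a hard-sphere Gibbs state of activity `z ≥ 0` at `β > 0`
(Ruelle 1969 (2.5)/(2.35): the one-point correlation function is `≤ z`). -/
theorem lintegral_count_le_activity_mul_volume {ε z β : ℝ} {u : V3} {μ : Measure (PointConfig (V3 × V3))}
    (h : IsHardSphereGibbs ε z β u μ) (hz : 0 ≤ z) (hβ : 0 < β) {Λ : Set V3} (hΛ : MeasurableSet Λ)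
    (hΛb : Bornology.IsBounded Λ) :
    ∫⁻ X, ((X.count (Λ ×ˢ (univ : Set V3)) : ℕ∞) : ℝ≥0∞) ∂μ ≤ ENNReal.ofReal z * volume Λ := by
  rw [← maxwellPhaseMeasure_univ hβ u Λ]
  exact lintegral_count_le_activity_mul_mass h hz hΛ hΛb

/-- **Registered helper stub `stub_gibbsIntensityLeActivity`** (file 1/3 of the density sandwich): for a hard-sphere Gibbs
state of activity `z ≥ 0` at `β > 0`, `E_μ[#(particles above Λ)] ≤ z · vol Λ` for every bounded measurable window. -/
theorem stub_gibbsIntensityLeActivity : ∀ (ε z β : ℝ) (u : V3) (μ : Measure (PointConfig (V3 × V3))), IsHardSphereGibbs ε z β u μ → 0 ≤ z → 0 < β → ∀ (Λ : Set V3), MeasurableSet Λ → Bornology.IsBounded Λ → ∫⁻ X, ((X.count (Λ ×ˢ (univ : Set V3)) : ℕ∞) : ℝ≥0∞) ∂μ ≤ ENNReal.ofReal z * volume Λ :=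
  fun _ _ _ _ _ h hz hβ _ hΛ hΛb => lintegral_count_le_activity_mul_volume h hz hβ hΛ hΛb

end Upper

end Summit.AtomisticToContinuum.HydrodynamicLimit.Theorems.KiferCompactification
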